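import Summits.Ventures.QEC.CircuitDistance.SchedXTable
import HarnessLib

/-!
# Q4 lane, ₛ-spine (8Z): the `Z`-sector TABLE machinery for any CNOT order (mirror of `SchedXTable.lean`; the `PortZTable.lean`
# layer of record re-pointed to `shapeₛ σ S` / `Gen.run1 S (allEventsₛ σ Nc)` under `hσ : σ.CycleFacts S`; venture QEC, experiment
# cell CDX, seat qec-cdx-type-2; nothing here asserts a value of `d_circ`)

Reused unchanged (order-free): `ZTable`, `ZTable.classRow/ClassCorrect`, `ZTable.colFormula`, `ZTable.detFast`, `ZNontrivial`,
`HZ_row_mem_rowSpace`, `HZ_row_translate`. Re-pointed, proofs verbatim: `ZTable.mX_of_tableₛ`, `dataZb_of_tableₛ`, `zDetₛ` (anchor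
`zDetₛ_sched204`), `ZTable.colFormula_eqₛ`, **`ZTable.detFast_eq_zDetₛ`**, `zDEMₛ`, **`classHyp_zDEMₛ`**.
-/

namespace Summit.Ventures.QEC.CircuitDistance

open Literature.InformationTheory.QuantumCodes

variable {ℓ m : ℕ} [NeZero ℓ] [NeZero m]

/-! ## Representatives from the table -/

/-- Shapes of arbitrary representatives from the table: in-cycle `X`-flips (cf. `ZTable.mX_of_table`). -/
theorem ZTable.mX_of_tableₛ {σ : SMSchedule} {S : SMCode ℓ m} {T : ZTable ℓ m} {k : ZKind} (h : T.shapeRowₛ σ S k = true) (c : ℕ)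
    (i i' : BB.Mono ℓ m) : (shapeₛ σ S (k.fault c i)).mX c i' = decide (i' - i ∈ T.muX k) := by
  rw [ZKind.fault_eq_translate, shapeₛ_translate, ZKind.fault_eq_retag, shapeₛ_retag]
  simp only [State.translate, ZKind.cyc_fault, if_true]
  exact (ZTable.shapeRowₛ_spec h).1 (i' - i)

/-- Shapes of arbitrary representatives from the table: residual support. -/
theorem ZTable.dataZb_of_tableₛ {σ : SMSchedule} {S : SMCode ℓ m} {T : ZTable ℓ m} {k : ZKind} (h : T.shapeRowₛ σ S k = true)
    (c : ℕ) (i : BB.Mono ℓ m) (q : BB.Mono ℓ m ⊕ BB.Mono ℓ m) :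
    (shapeₛ σ S (k.fault c i)).frame.dataZb q = decide (q ∈ trQ i (T.ez k)) := by
  rw [ZKind.fault_eq_translate, shapeₛ_translate, dataZb_translate, ZKind.fault_eq_retag, shapeₛ_retag]
  exact ((ZTable.shapeRowₛ_spec h).2 _).trans (decide_eq_decide.mpr (mem_trQ i _ q).symm)

/-! ## The column and the fast column -/

/-- The true `Z`-sector column detector set of a fault in the `Nc`-cycle circuit of `σ` (cf. `zDet`). -/
def zDetₛ (σ : SMSchedule) (S : SMCode ℓ m) (Nc : ℕ) (f : Fault ℓ m) : Finset (ℕ × BB.Mono ℓ m) :=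
  ((Finset.range (Nc + 2)) ×ˢ (Finset.univ : Finset (BB.Mono ℓ m))).filter fun p =>
    Gen.detX S Nc (allEventsₛ σ Nc) {f} (p.1 + 1) p.2

/-- ANCHOR: under print's order `zDetₛ` is the landed `zDet`. -/
theorem zDetₛ_sched204 (S : SMCode ℓ m) (Nc : ℕ) (f : Fault ℓ m) : zDetₛ sched204 S Nc f = zDet S Nc f := by
  unfold zDetₛ zDet; rw [allEventsₛ_sched204]; rfl

/-- The (order-free) column FORMULA is the column of the representative in `σ`'s circuit (cf. `ZTable.colFormula_eq`). -/
theorem ZTable.colFormula_eqₛ {σ : SMSchedule} {S : SMCode ℓ m} (hσ : σ.CycleFacts S) {T : ZTable ℓ m} {k : ZKind}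
    (h : T.shapeRowₛ σ S k = true) (Nc : ℕ) (i : BB.Mono ℓ m) (c : ℕ) (h₁ : 1 ≤ c) (h₂ : c ≤ Nc) (s : ℕ) (i' : BB.Mono ℓ m) :
    T.colFormula S k i c s i' = Gen.detX S Nc (allEventsₛ σ Nc) {k.fault c i} (s + 1) i' := by
  have hc : (k.fault c i : Fault ℓ m).cyc = c := ZKind.cyc_fault k c i
  rw [detXₛ_singleton hσ Nc (k.fault c i) (by rw [hc]; exact h₁) (by rw [hc]; exact h₂), hc, ZTable.mX_of_tableₛ h c i i']
  have hd : (shapeₛ σ S (k.fault c i)).frame.dataZb = fun q => decide (q ∈ trQ i (T.ez k)) :=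
    funext fun q => ZTable.dataZb_of_tableₛ h c i q
  rw [hd]
  rfl

/-- **The fast column is the column**, in the circuit of any order with the cycle facts (cf. `ZTable.detFast_eq_zDet`). -/
theorem ZTable.detFast_eq_zDetₛ {σ : SMSchedule} {S : SMCode ℓ m} (hσ : σ.CycleFacts S) {T : ZTable ℓ m} {k : ZKind}
    (h : T.shapeRowₛ σ S k = true) (Nc : ℕ) (i : BB.Mono ℓ m) (c : ℕ) (h₁ : 1 ≤ c) (h₂ : c ≤ Nc) :
    T.detFast S k i c = zDetₛ σ S Nc (k.fault c i) := by
  ext ⟨s, i'⟩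
  simp only [ZTable.detFast, zDetₛ, Finset.mem_filter, Finset.mem_product, Finset.mem_univ, and_true, Finset.mem_range,
    Finset.mem_insert, Finset.mem_singleton, ZTable.colFormula_eqₛ hσ h Nc i c h₁ h₂]
  constructor
  · rintro ⟨hs, hd⟩
    refine ⟨?_, hd⟩
    rcases hs with rfl | rfl
    · omega
    · omega
  · rintro ⟨-, hd⟩
    refine ⟨?_, hd⟩
    have hc : (k.fault c i : Fault ℓ m).cyc = c := ZKind.cyc_fault k c i
    rw [detXₛ_singleton hσ Nc (k.fault c i) (by rw [hc]; exact h₁) (by rw [hc]; exact h₂), hc] at hd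
    by_contra hne
    push Not at hne
    have e1 : ¬ (s + 1 = c) := by omega
    have e2 : ¬ (s + 1 = c + 1) := by omega
    rw [decide_eq_false e1, decide_eq_false e2] at hd
    simp at hd

/-! ## The `Z`-sector DEM of a scheduled circuit and its class hypothesis -/

/-- The `Z`-sector DEM of the `Nc`-cycle circuit of order `σ`, classes read off the table `T` (cf. `zDEM`). -/
def zDEMₛ (σ : SMSchedule) (S : SMCode ℓ m) (T : ZTable ℓ m) (Nc : ℕ) :
    Fibre.DEM (Fault ℓ m) (ℕ × BB.Mono ℓ m) (Finset (BB.Mono ℓ m ⊕ BB.Mono ℓ m)) (BB.Mono ℓ m ⊕ BB.Mono ℓ m → ZMod 2) where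
  det := zDetₛ σ S Nc
  res := fun f => Gen.dataZ S (allEventsₛ σ Nc) {f}
  cls := fun f => f.zKind.bind fun ki => (T.cls ki.1).map (trQ ki.2)
  gen := indic
  stab := rowSpace S.toCode.HZ

/-- **Class hypothesis of the `Z`-sector DEM** of `σ`'s circuit from a shape-correct (for `σ`) and class-correct table
(cf. `classHyp_zDEM`). -/
theorem classHyp_zDEMₛ {σ : SMSchedule} {S : SMCode ℓ m} (hσ : σ.CycleFacts S) (T : ZTable ℓ m) (hS : T.ShapeCorrectₛ σ S)
    (hC : T.ClassCorrect S) (Nc : ℕ) : Fibre.ClassHyp (zDEMₛ σ S T Nc) (scope Nc) := by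
  intro f hf
  obtain ⟨h₁, h₂⟩ := hf
  rcases hk : f.zKind with _ | ⟨k, i⟩
  · have h0 := (Gen.zColumn_zero_of_zKind S Nc (allEventsₛ σ Nc) f hk).2
    refine ⟨fun _ => ?_, fun g hg => ?_⟩
    · show Gen.dataZ S (allEventsₛ σ Nc) {f} ∈ rowSpace S.toCode.HZ; rw [h0]; exact Submodule.zero_mem _
    · simp [zDEMₛ, hk] at hg
  · have hkall : k ∈ ZKind.all := ZKind.mem_all k (fun lay => Fault.zKind_ne_zero hk lay)
    have hrow := hS k hkall
    have hcls := hC k hkall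
    unfold ZTable.classRow at hcls
    rw [decide_eq_true_eq] at hcls
    have hres : Gen.dataZ S (allEventsₛ σ Nc) {f} = indic (trQ i (T.ez k)) := by
      rw [(Gen.zColumn_eq_of_zKind S Nc (allEventsₛ σ Nc) f hk).2,
        dataZₛ_singleton hσ Nc (k.fault f.cyc i) (by rw [ZKind.cyc_fault]; exact h₁) (by rw [ZKind.cyc_fault]; exact h₂)]
      funext q; unfold toZ2 indic; rw [ZTable.dataZb_of_tableₛ hrow]
      by_cases hq : q ∈ trQ i (T.ez k) <;> simp [hq]
    have hsum : indic (trQ i (T.ez k)) = indic (trQ i ((T.cls k).getD ∅)) + ∑ r ∈ T.cert k, fun q => S.toCode.HZ (r + i) q := by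
      rw [indic_trQ, indic_trQ, hcls]
      funext q
      simp only [Pi.add_apply, Finset.sum_apply]
      congr 1
      apply Finset.sum_congr rfl
      intro r _
      exact congrFun (HZ_row_translate S r i) q
    have hstab : (∑ r ∈ T.cert k, fun q => S.toCode.HZ (r + i) q) ∈ rowSpace S.toCode.HZ :=
      Submodule.sum_mem _ fun r _ => HZ_row_mem_rowSpace S (r + i)
    refine ⟨fun hnone => ?_, fun g hg => ?_⟩
    · simp only [zDEMₛ, hk, Option.bind_some] at hnone
      rw [Option.map_eq_none_iff] at hnone
      show Gen.dataZ S (allEventsₛ σ Nc) {f} ∈ rowSpace S.toCode.HZ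
      rw [hres, hsum, hnone]
      simp only [Option.getD_none]
      have : indic (trQ i (∅ : Finset (BB.Mono ℓ m ⊕ BB.Mono ℓ m))) = 0 := by
        funext q; simp [indic, trQ]
      rw [this, zero_add]; exact hstab
    · simp only [zDEMₛ, hk, Option.bind_some] at hg
      obtain ⟨g₀, hg₀, rfl⟩ := Option.map_eq_some_iff.1 hg
      show Gen.dataZ S (allEventsₛ σ Nc) {f} - indic (trQ i g₀) ∈ rowSpace S.toCode.HZ
      rw [hres, hsum, hg₀]
      simp only [Option.getD_some, add_sub_cancel_left]
      exact hstab

end Summit.Ventures.QEC.CircuitDistance
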